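import Summits.BirchSwinnertonDyer.BirchSwinnertonDyer.Theorems.AlignedTransportAtTwoMainConjectureTransportAlignedAtTwoKilfordCopyCrossLevelSquarefreePairs
import Literature.NumberTheory.EllipticCurves.NewformsOldHeckeStableProofs
import HarnessLib

/-!
# Crux C1 `MainConjectureTransportAlignedAtTwo` (stmt-BirchSwinnertonDyer-22296), line `birth`, residual (R2) `stub_lamLawKilford`, UNEQUAL conductors:
# THE HECKE ROW OF THE MULTI-PRIME OLD LINE `F_Q = Σ_{T⊆Q}(∏T)·ι_{∏T} f` at the common level `L = N₁·∏Q` — `T_p F_Q = a_p F_Q` off `Q` and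
# `U_q F_Q ≡ F_Q (mod 2·old lattice)` for `q ∈ Q` (width seat att-p3 g18; `--supports 22296`)

THEOREMS ONLY (no `def`, no `sorry`, no named fact). Row (r3) of memo CROSS-LEVEL-att-p3-g18 §6 for the multi-prime old lines of
`…KilfordCopyCrossLevelSquarefreePairs` / `…TwoSided` (the one-prime row is `…CrossLevelHecke`): what the level-`L` kernel-letter carrier needs from the old-line
map `θ_F` — it is Hecke-equivariant off `Q` with the eigenvalues of `f`, and `U_q − 1` moves its half-periods by INTEGRAL periods (`a_q(f)` even, `q` odd), so
`θ_F` kills `(U_q − 1)·J₀(L)[2]`. Pure `q`-expansion bookkeeping (Diamond–Shurman Prop. 5.6.2) + Cremona §2.4 integrality of old periods. BSD is not proved by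
this; C1 is not closed by this.

* §1 `oldLines_eq_sum` — the `m`-old line as the explicit old-basis combination `Σ_{T⊆Q}(∏T)•ι_{∏T} f`.
* §2 **`heckeT_oldLines_of_not_mem`** — `T_p F_Q = a_p(f)·F_Q` for every prime `p ∉ Q` with `p ∣ N₁ ↔ p ∣ L` (so all `p ∤ L` and all `p ∣ N₁`).
* §3 **`heckeT_oldLines_of_mem`** — for `q ∈ Q` (`q ∤ N₁`, `q` odd, `a_q(f)` even): `U_q F_Q = F_Q + 2·G` with `G = Σ_{S⊆Q∖q}(∏S)·(k·ι_{∏S} f − q·ι_{q∏S} f)`,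
  `2k = a_q(f) + q − 1`, and `c·y(G) ∈ Λ` for every cycle `y ∈ H₁(X₀(L);ℤ)` whenever `c·Λ_f ⊆ Λ`.

References: Diamond–Shurman 2005 Prop. 5.6.2, §5.7 [DiamondShurman2005]; Cremona 1997 §2.4 [CremonaAlgorithms1997]; Ribet 1990 §3 [Ribet1990RaisingLevels].
-/

noncomputable section

-- justification: the `Summit.BirchSwinnertonDyer.BirchSwinnertonDyer.…` path repeats a component (route-file convention)
set_option linter.dupNamespace false
set_option autoImplicit false

open scoped MatrixGroups ModularForm Classical

open CongruenceSubgroup Complex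
open Literature.NumberTheory.EllipticCurves Literature.NumberTheory.EllipticCurves.ModularForms
open Summit.BirchSwinnertonDyer.BirchSwinnertonDyer.Theorems.MazurTateCongruenceAtTwoR.DepletedLattice (modularSymbol_iota)
open Summit.BirchSwinnertonDyer.BirchSwinnertonDyer.Theorems.AlignedTransportAtTwoKilfordCopyCrossLevelTools
open Summit.BirchSwinnertonDyer.BirchSwinnertonDyer.Theorems.AlignedTransportAtTwoKilfordCopyCrossLevelSquarefreePairs

namespace Summit.BirchSwinnertonDyer.BirchSwinnertonDyer.Theorems.AlignedTransportAtTwoKilfordCopyCrossLevelOldLinesHecke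

/-! ## §1 The `m`-old line in the old basis -/

/-- **The `m`-old line is `Σ_{T⊆Q} (∏T)•ι_{∏T} f`** (`q`-expansion principle). [cite: DiamondShurman2005, §5.7] -/
theorem oldLines_eq_sum {N₁ L : ℕ} [NeZero N₁] [NeZero L] (Q : Finset ℕ) (hQ0 : ∀ q ∈ Q, q ≠ 0) (hL : N₁ * ∏ q ∈ Q, q ∣ L)
    (f : CuspForm (Gamma0 N₁) 2) (F : CuspForm (Gamma0 L) 2)
    (hF : ∀ n : ℕ, cuspCoeff F n = ∑ T ∈ Q.powerset, ((∏ q ∈ T, q : ℕ) : ℂ) * (if (∏ q ∈ T, q) ∣ n then cuspCoeff f (n / ∏ q ∈ T, q) else 0))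
    (hne : ∀ T ∈ Q.powerset, (∏ q ∈ T, q) ≠ 0) (hdiv : ∀ T ∈ Q.powerset, N₁ * ∏ q ∈ T, q ∣ L) :
    F = ∑ T ∈ Q.powerset.attach, ((∏ q ∈ T.1, q : ℕ) : ℂ) • @iota N₁ L (∏ q ∈ T.1, q) ⟨hne T.1 T.2⟩ 2 (hdiv T.1 T.2) f := by
  have _ := hQ0; have _ := hL
  refine eq_of_forall_cuspCoeff_eq_gamma0 fun n ↦ ?_
  rw [hF n, cuspCoeff_finset_sum, ← Finset.sum_attach Q.powerset]
  refine Finset.sum_congr rfl fun T _ ↦ ?_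
  haveI : NeZero (∏ q ∈ T.1, q) := ⟨hne T.1 T.2⟩
  simp only [cuspCoeff, qExpansion_coeff_smul, qExpansion_coeff_iota]

/-! ## §2 `T_p F_Q = a_p F_Q` off `Q` -/

/-- **The `m`-old line is a `T_p`-eigenform off `Q`** with the eigenvalue of `f`: for a prime `p ∉ Q` with `p ∣ N₁ ↔ p ∣ L` (every `p ∤ L` and every
`p ∣ N₁` when `L = N₁·∏Q`), `T_p F_Q = a·F_Q` if `T_p f = a·f` (`T_p ι_d = ι_d T_p` for `p ∤ d`). [cite: DiamondShurman2005, Prop. 5.6.2] -/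
theorem heckeT_oldLines_of_not_mem {N₁ L : ℕ} [NeZero N₁] [NeZero L] (Q : Finset ℕ) (hQ : ∀ q ∈ Q, q.Prime) (hL : N₁ * ∏ q ∈ Q, q ∣ L)
    (f : CuspForm (Gamma0 N₁) 2) (F : CuspForm (Gamma0 L) 2)
    (hF : ∀ n : ℕ, cuspCoeff F n = ∑ T ∈ Q.powerset, ((∏ q ∈ T, q : ℕ) : ℂ) * (if (∏ q ∈ T, q) ∣ n then cuspCoeff f (n / ∏ q ∈ T, q) else 0))
    {p : ℕ} (hp : p.Prime) (hpQ : p ∉ Q) (hpL : p ∣ N₁ ↔ p ∣ L) (a : ℂ)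
    (hT : (haveI : NeZero p := ⟨hp.ne_zero⟩; heckeT (Gamma0 N₁) 2 p f) = a • f) :
    (haveI : NeZero p := ⟨hp.ne_zero⟩; heckeT (Gamma0 L) 2 p F) = a • F := by
  classical
  haveI : NeZero p := ⟨hp.ne_zero⟩
  have hQ0 : ∀ q ∈ Q, q ≠ 0 := fun q hq ↦ (hQ q hq).ne_zero
  have hne : ∀ T ∈ Q.powerset, (∏ q ∈ T, q) ≠ 0 := fun T hT ↦
    Finset.prod_ne_zero_iff.mpr fun q hq ↦ hQ0 q (Finset.mem_powerset.mp hT hq)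
  have hdiv : ∀ T ∈ Q.powerset, N₁ * ∏ q ∈ T, q ∣ L := fun T hT ↦
    (mul_dvd_mul_left N₁ (Finset.prod_dvd_prod_of_subset _ _ _ (Finset.mem_powerset.mp hT))).trans hL
  have hpd : ∀ T ∈ Q.powerset, ¬ p ∣ ∏ q ∈ T, q := by
    intro T hT h
    obtain ⟨q, hq, hpq⟩ := (Prime.dvd_finsetProd_iff hp.prime _).mp h
    have hqQ : q ∈ Q := Finset.mem_powerset.mp hT hq
    exact hpQ (((Nat.prime_dvd_prime_iff_eq hp (hQ q hqQ)).mp hpq) ▸ hqQ)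
  rw [oldLines_eq_sum Q hQ0 hL f F hF hne hdiv, map_sum, Finset.smul_sum]
  refine Finset.sum_congr rfl fun T _ ↦ ?_
  haveI : NeZero (∏ q ∈ T.1, q) := ⟨hne T.1 T.2⟩
  rw [map_smul, heckeT_iota_of_not_dvd (hdiv T.1 T.2) hp (hpd T.1 T.2) hpL, hT, map_smul, smul_comm]

/-! ## §3 `U_q F_Q ≡ F_Q (mod 2 · old lattice)` for `q ∈ Q` -/

/-- Integrality of the weighted old periods: `c·(d·y(ι_d f)) ∈ Λ` for `y ∈ H₁(X₀(L);ℤ)`, `N₁ d ∣ L`, `c·Λ_f ⊆ Λ` (`{∞,γ∞}_{ι_d f} = d⁻¹{∞, d·γ∞}_f` and `d·γ∞`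
is a `Γ₀(N₁)`-translate of `∞`). [cite: CremonaAlgorithms1997, §2.4] -/
theorem mul_mul_apply_iota_mem {N₁ L : ℕ} [NeZero L] {d : ℕ} [NeZero d] (hd : N₁ * d ∣ L) (f : CuspForm (Gamma0 N₁) 2)
    (Λ : AddSubgroup ℂ) (c : ℂ) (hc : ∀ z ∈ periodLattice f, c * z ∈ Λ)
    {y : Module.Dual ℂ (CuspForm (Gamma0 L) 2)} (hy : y ∈ periodHomology L) :
    c * ((d : ℂ) * y (iota N₁ L d 2 hd f)) ∈ Λ := by
  have hy' : y ∈ (periodHomology L : Set (Module.Dual ℂ (CuspForm (Gamma0 L) 2))) := hy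
  rw [coe_periodHomology_eq_range] at hy'
  obtain ⟨γ, rfl⟩ := hy'
  rw [periodFunctional_apply]
  by_cases hγ : (γ : SL(2, ℤ)) 1 0 = 0
  · simp only [cuspSymbol, if_pos hγ, mul_zero, Λ.zero_mem]
  obtain ⟨δ, hδ, hδr⟩ := exists_gamma0_dilate_cusp (NeZero.ne d) hd γ hγ
  have hd0 : (d : ℂ) ≠ 0 := by exact_mod_cast NeZero.ne d
  have h : cuspSymbol f δ = modularSymbol f ((d : ℚ) * ((((γ : SL(2, ℤ)) 0 0 : ℚ) / ((γ : SL(2, ℤ)) 1 0 : ℚ)))) := by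
    rw [cuspSymbol, if_neg hδ, hδr]
  rw [cuspSymbol, if_neg hγ, modularSymbol_iota, ← mul_assoc (d : ℂ), mul_inv_cancel₀ hd0, one_mul, ← h]
  exact hc _ (cuspSymbol_mem_periodLattice f δ)

/-- **`U_q F_Q = F_Q + 2·G` with `G` in the old lattice**, for `q ∈ Q` (`q ∤ N₁`, `q` odd, `a_q(f)` even): `G = Σ_{S⊆Q∖q}(∏S)·(k·ι_{∏S} f − q·ι_{q∏S} f)`
with `2k = a_q(f) + q − 1`, and `c·y(G) ∈ Λ` for every cycle `y ∈ H₁(X₀(L);ℤ)` (`c·Λ_f ⊆ Λ`). On `q`-expansions: `a_n(U_q F) = a_{qn}(F)`, `a_{qm}(f) =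
a_q a_m − q·𝟙_{q∣m} a_{m/q}` (`T_q f = a_q f`, `q ∤ N₁`), and the subsets of `Q` pair off as `(S, S ∪ {q})`. So the old-line map kills `(U_q − 1)·J₀(L)[2]`.
[cite: DiamondShurman2005, Prop. 5.6.2] [cite: CremonaAlgorithms1997, §2.4] -/
theorem heckeT_oldLines_of_mem {N₁ L : ℕ} [NeZero N₁] [NeZero L] (Q : Finset ℕ) (hQ : ∀ q ∈ Q, q.Prime) (hQN₁ : ∀ q ∈ Q, ¬ q ∣ N₁)
    (hL : L = N₁ * ∏ q ∈ Q, q) (f : CuspForm (Gamma0 N₁) 2) (A : ℕ → ℤ) (hA : ∀ n, cuspCoeff f n = A n)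
    (hT : ∀ (p : ℕ) (hp : p.Prime), (haveI : NeZero p := ⟨hp.ne_zero⟩; heckeT (Gamma0 N₁) 2 p f) = cuspCoeff f p • f)
    (F : CuspForm (Gamma0 L) 2)
    (hF : ∀ n : ℕ, cuspCoeff F n = ∑ T ∈ Q.powerset, ((∏ q ∈ T, q : ℕ) : ℂ) * (if (∏ q ∈ T, q) ∣ n then cuspCoeff f (n / ∏ q ∈ T, q) else 0))
    {q : ℕ} (hq : q ∈ Q) (hqodd : Odd q) (hAq : Even (A q))
    (Λ : AddSubgroup ℂ) (c : ℂ) (hc : ∀ z ∈ periodLattice f, c * z ∈ Λ) :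
    ∃ G : CuspForm (Gamma0 L) 2, (haveI : NeZero q := ⟨(hQ q hq).ne_zero⟩; heckeT (Gamma0 L) 2 q F) = F + (2 : ℂ) • G ∧
      ∀ y ∈ periodHomology L, c * y G ∈ Λ := by
  classical
  have hqp : q.Prime := hQ q hq
  haveI : NeZero q := ⟨hqp.ne_zero⟩
  have hq0 : q ≠ 0 := hqp.ne_zero
  have hQ0 : ∀ q ∈ Q, q ≠ 0 := fun q hq ↦ (hQ q hq).ne_zero
  set Q' : Finset ℕ := Q.erase q with hQ'
  have hqQ' : q ∉ Q' := fun h ↦ (Finset.mem_erase.mp h).1 rfl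
  have hQQ' : Q = insert q Q' := (Finset.insert_erase hq).symm
  have hPQ : q * ∏ x ∈ Q', x = ∏ x ∈ Q, x := Finset.mul_prod_erase Q (fun x ↦ x) hq
  have hLdvd : N₁ * ∏ x ∈ Q, x ∣ L := by rw [hL]
  have hqL : q ∣ L := by rw [hL, ← hPQ]; exact ⟨N₁ * ∏ x ∈ Q', x, by ring⟩
  -- nonvanishing / divisibility of the indices
  have hne' : ∀ T ∈ Q'.powerset, (∏ x ∈ T, x) ≠ 0 := fun T hT ↦
    Finset.prod_ne_zero_iff.mpr fun x hx ↦ hQ0 x (Finset.mem_of_mem_erase (Finset.mem_powerset.mp hT hx))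
  have hsub : ∀ T ∈ Q'.powerset, insert q T ⊆ Q := fun T hT ↦
    Finset.insert_subset hq ((Finset.mem_powerset.mp hT).trans (Finset.erase_subset q Q))
  have hqT : ∀ T ∈ Q'.powerset, q ∉ T := fun T hT h ↦ hqQ' (Finset.mem_powerset.mp hT h)
  have hdiv₁ : ∀ T ∈ Q'.powerset, N₁ * ∏ x ∈ T, x ∣ L := fun T hT ↦
    (mul_dvd_mul_left N₁ (Finset.prod_dvd_prod_of_subset _ _ _ ((Finset.mem_powerset.mp hT).trans (Finset.erase_subset q Q)))).trans hLdvd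
  have hdiv₂ : ∀ T ∈ Q'.powerset, N₁ * (q * ∏ x ∈ T, x) ∣ L := by
    intro T hT
    rw [show q * ∏ x ∈ T, x = ∏ x ∈ insert q T, x from (Finset.prod_insert (f := fun x : ℕ ↦ x) (hqT T hT)).symm]
    exact (mul_dvd_mul_left N₁ (Finset.prod_dvd_prod_of_subset _ _ _ (hsub T hT))).trans hLdvd
  -- `2k = a_q + q − 1`
  obtain ⟨k, hk⟩ : Even (A q + q - 1) := by
    have h1 : Odd (A q + (q : ℤ)) := hAq.add_odd (by exact_mod_cast hqodd)
    exact h1.sub_odd odd_one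
  -- the correction form
  set G : CuspForm (Gamma0 L) 2 := ∑ T ∈ Q'.powerset.attach, ((∏ x ∈ T.1, x : ℕ) : ℂ) •
    (((k : ℤ) : ℂ) • @iota N₁ L (∏ x ∈ T.1, x) ⟨hne' T.1 T.2⟩ 2 (hdiv₁ T.1 T.2) f -
      (q : ℂ) • @iota N₁ L (q * ∏ x ∈ T.1, x) ⟨mul_ne_zero hq0 (hne' T.1 T.2)⟩ 2 (hdiv₂ T.1 T.2) f) with hG
  have hGn : ∀ n : ℕ, cuspCoeff G n = ∑ T ∈ Q'.powerset, ((∏ x ∈ T, x : ℕ) : ℂ) *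
      (((k : ℤ) : ℂ) * (if (∏ x ∈ T, x) ∣ n then cuspCoeff f (n / ∏ x ∈ T, x) else 0) -
        (q : ℂ) * (if (q * ∏ x ∈ T, x) ∣ n then cuspCoeff f (n / (q * ∏ x ∈ T, x)) else 0)) := by
    intro n
    rw [hG, cuspCoeff_finset_sum, ← Finset.sum_attach Q'.powerset (fun T ↦ ((∏ x ∈ T, x : ℕ) : ℂ) *
      (((k : ℤ) : ℂ) * (if (∏ x ∈ T, x) ∣ n then cuspCoeff f (n / ∏ x ∈ T, x) else 0) -
        (q : ℂ) * (if (q * ∏ x ∈ T, x) ∣ n then cuspCoeff f (n / (q * ∏ x ∈ T, x)) else 0)))]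
    refine Finset.sum_congr rfl fun T _ ↦ ?_
    haveI : NeZero (∏ x ∈ T.1, x) := ⟨hne' T.1 T.2⟩
    haveI : NeZero (q * ∏ x ∈ T.1, x) := ⟨mul_ne_zero hq0 (hne' T.1 T.2)⟩
    simp only [cuspCoeff, qExpansion_coeff_smul, qExpansion_coeff_sub_level0, qExpansion_coeff_iota]
  -- Hecke relations: `a_n(U_q F) = a_{qn}(F)` and `a_{qm}(f) = a_q a_m − q 𝟙_{q∣m} a_{m/q}`
  have hUn : ∀ n : ℕ, cuspCoeff (heckeT (Gamma0 L) 2 q F) n = cuspCoeff F (q * n) := by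
    intro n
    rw [cuspCoeff, qExpansion_coeff_heckeT_holds L 2 F q hqp n, if_pos hqL, add_zero, cuspCoeff]
  have hfq : ∀ m : ℕ, cuspCoeff f (q * m) = cuspCoeff f q * cuspCoeff f m - (q : ℂ) * (if q ∣ m then cuspCoeff f (m / q) else 0) := by
    intro m
    have h := qExpansion_coeff_heckeT_holds N₁ 2 f q hqp m
    rw [hT q hqp, qExpansion_coeff_smul, if_neg (hQN₁ q hq)] at h
    have h1 : ((q : ℂ) ^ ((2 : ℤ) - 1)) = q := by norm_num
    rw [h1] at h
    simp only [cuspCoeff] at h ⊢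
    linear_combination -h
  -- the `q`-expansion identity, subset by subset
  have hsplit : ∀ (m : ℕ), cuspCoeff F m = ∑ S ∈ Q'.powerset, (((∏ x ∈ S, x : ℕ) : ℂ) * (if (∏ x ∈ S, x) ∣ m then cuspCoeff f (m / ∏ x ∈ S, x) else 0) +
      ((q * ∏ x ∈ S, x : ℕ) : ℂ) * (if (q * ∏ x ∈ S, x) ∣ m then cuspCoeff f (m / (q * ∏ x ∈ S, x)) else 0)) := by
    intro m
    rw [hF m, hQQ', Finset.sum_powerset_insert hqQ', ← Finset.sum_add_distrib]
    refine Finset.sum_congr rfl fun S hS ↦ ?_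
    rw [Finset.prod_insert (hqT S hS)]
  have key : ∀ n : ℕ, cuspCoeff F (q * n) = cuspCoeff F n + 2 * cuspCoeff G n := by
    intro n
    rw [hsplit, hsplit, hGn, Finset.mul_sum, ← Finset.sum_add_distrib]
    refine Finset.sum_congr rfl fun S hS ↦ ?_
    set d : ℕ := ∏ x ∈ S, x with hd
    have hd0 : d ≠ 0 := hne' S hS
    have hqd : ¬ q ∣ d := by
      intro h
      obtain ⟨x, hx, hqx⟩ := (Prime.dvd_finsetProd_iff hqp.prime _).mp h
      have hxQ : x ∈ Q := Finset.mem_of_mem_erase (Finset.mem_powerset.mp hS hx)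
      exact hqT S hS (((Nat.prime_dvd_prime_iff_eq hqp (hQ x hxQ)).mp hqx) ▸ hx)
    have hcop : Nat.Coprime d q := Nat.coprime_comm.mp ((Nat.Prime.coprime_iff_not_dvd hqp).mpr hqd)
    have e1 : d ∣ q * n ↔ d ∣ n := by rw [mul_comm]; exact hcop.dvd_mul_right
    have e2 : q * d ∣ q * n ↔ d ∣ n := Nat.mul_dvd_mul_iff_left hqp.pos
    by_cases hdn : d ∣ n
    · have e3 : q * n / d = q * (n / d) := Nat.mul_div_assoc q hdn
      have e4 : q * n / (q * d) = n / d := Nat.mul_div_mul_left n d hqp.pos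
      have e5 : q * d ∣ n ↔ q ∣ n / d := by
        rw [mul_comm]; exact (Nat.dvd_div_iff_mul_dvd hdn).symm
      have e6 : n / (q * d) = n / d / q := by rw [mul_comm, Nat.div_div_eq_div_mul]
      rw [if_pos (e1.mpr hdn), if_pos (e2.mpr hdn), if_pos hdn, e3, e4, hfq (n / d)]
      by_cases hqm : q ∣ n / d
      · rw [if_pos hqm, if_pos (e5.mpr hqm), e6, hA q]
        push_cast
        have hk' : ((A q : ℤ) : ℂ) = 2 * (k : ℂ) - q + 1 := by
          have := congrArg (fun z : ℤ ↦ (z : ℂ)) hk; push_cast at this; linear_combination this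
        rw [hk']; ring
      · rw [if_neg hqm, if_neg (fun h ↦ hqm (e5.mp h)), hA q]
        push_cast
        have hk' : ((A q : ℤ) : ℂ) = 2 * (k : ℂ) - q + 1 := by
          have := congrArg (fun z : ℤ ↦ (z : ℂ)) hk; push_cast at this; linear_combination this
        rw [hk']; ring
    · have h1 : ¬ q * d ∣ n := fun h ↦ hdn ((Dvd.intro_left _ rfl : d ∣ q * d).trans h)
      rw [if_neg (fun h ↦ hdn (e1.mp h)), if_neg (fun h ↦ hdn (e2.mp h)), if_neg hdn, if_neg h1]
      ring
  refine ⟨G, eq_of_forall_cuspCoeff_eq_gamma0 fun n ↦ ?_, fun y hy ↦ ?_⟩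
  · rw [hUn, key, cuspCoeff, cuspCoeff, cuspCoeff, qExpansion_coeff_add_level0, qExpansion_coeff_smul]
  · -- integrality of `c·y(G)`
    rw [hG, map_sum, Finset.mul_sum]
    refine AddSubgroup.sum_mem Λ fun T _ ↦ ?_
    haveI : NeZero (∏ x ∈ T.1, x) := ⟨hne' T.1 T.2⟩
    haveI : NeZero (q * ∏ x ∈ T.1, x) := ⟨mul_ne_zero hq0 (hne' T.1 T.2)⟩
    have i1 := mul_mul_apply_iota_mem (hdiv₁ T.1 T.2) f Λ c hc hy
    have i2 := mul_mul_apply_iota_mem (hdiv₂ T.1 T.2) f Λ c hc hy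
    rw [map_smul, map_sub, map_smul, map_smul, smul_eq_mul, smul_eq_mul, smul_eq_mul]
    have e : c * (((∏ x ∈ T.1, x : ℕ) : ℂ) * (((k : ℤ) : ℂ) * y (iota N₁ L (∏ x ∈ T.1, x) 2 (hdiv₁ T.1 T.2) f) -
        (q : ℂ) * y (iota N₁ L (q * ∏ x ∈ T.1, x) 2 (hdiv₂ T.1 T.2) f))) =
        (k : ℤ) • (c * (((∏ x ∈ T.1, x : ℕ) : ℂ) * y (iota N₁ L (∏ x ∈ T.1, x) 2 (hdiv₁ T.1 T.2) f))) -
          c * (((q * ∏ x ∈ T.1, x : ℕ) : ℂ) * y (iota N₁ L (q * ∏ x ∈ T.1, x) 2 (hdiv₂ T.1 T.2) f)) := by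
      rw [zsmul_eq_mul]; push_cast; ring
    rw [e]
    exact Λ.sub_mem (Λ.zsmul_mem i1 k) i2

end Summit.BirchSwinnertonDyer.BirchSwinnertonDyer.Theorems.AlignedTransportAtTwoKilfordCopyCrossLevelOldLinesHecke

end
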